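import Literature.AnabelianGeometry.SemiGraphs.RelCosetCategories
import Literature.AlgebraicGeometry.Frobenioids.PadicFrobenioidDZeroSlim
import Literature.AlgebraicGeometry.Frobenioids.PadicFrobenioidModelType
import Literature.AlgebraicGeometry.Frobenioids.PadicFrobenioidConstantMonoid
import Literature.AlgebraicGeometry.Frobenioids.QuasiTemperoidGaloisPadicFields
import Literature.AlgebraicGeometry.Frobenioids.QuasiTemperoidGaloisFieldsEquivalence
import HarnessLib

/-!
# Frobenioids II, Example 1.3 (iii) at the Datum level: `D = 𝓑^temp(Π, Π°)⁰ → D₀ → (p-adic fields)` on the small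
# models, and "the hypotheses of Theorem 1.2 (i)" — hence Theorem 1.2 — for every `p`-adic Frobenioid over `D`

Mochizuki, *The geometry of Frobenioids II*, Kyushu J. Math. **62** (2008) 401–460, §1 Example 1.3 (iii), author's text
pp. 11–12 [cite: MochizukiFrdII2008, Ex 1.3 (iii) pp.11-12]: "any open homomorphism `Π → Q` from a tempered topological
group `Π`, equipped with an open subgroup `Π° ⊆ Π`, to a quotient `G_F ↠ Q` of the absolute Galois group `G_F` … determines
a functor `𝓑^temp(Π, Π°)⁰ ↪ 𝓑^temp(Π)⁰ → 𝓑^temp(Q)⁰ ↪ 𝓑^temp(G_F)⁰` … between connected, totally epimorphic categories of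
FSM-type. In particular, when `F = ℚ_p`, if we set `D := 𝓑^temp(Π, Π°)⁰`, then we obtain a functor `D → D₀ = 𝓑^temp(G_{ℚ_p})⁰`
[cf. Example 1.1, (ii)] which satisfies the hypotheses of Theorem 1.2, (i). That is to say, in this case, the main results
of the theory of [Mzk5] may be applied to the `p`-adic Frobenioids of Example 1.1, (ii)."

The tree proves the displayed functor and the three properties on the BIG models (`QuasiTemperoid.galoisBaseFunctor`,
`galoisBaseFunctor_holds`, abc-iut-L1-t4; the junction `𝓑^temp(G_{ℚ_p})⁰ → (finite extensions of ℚ_p)` is abc-iut-w4-d018's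
`QuasiTemperoid.galoisPadicFields`). The kernel form of Theorem 1.2 quantifies over `PadicFrd.Datum D p`, whose base
`D ⥤ PadicFld.{u} p` must live in the universe of its fields — which the big `ConnectedPart (BTempRel Π Π°) : Type 1` does
not. This file realises the last two printed sentences on the SMALL models (`RelCosetCat Π° ≌ ConnectedPart (BTempRel Π Π°)`,
`RelCosetCategories.lean`; `CosetCat`, abc-iut-L5-t2):

* `PadicFrd.relBase p Π° φ π : RelCosetCat Π° ⥤ PadicFld p` — print's composite on small models:
  `RelCosetCat Π° ⥤ CosetCat Π ⥤(φ_*) CosetCat Q ⥤(π^*) CosetCat G_{ℚ_p} ⥤ PadicFld p` for an open homomorphism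
  `φ : Π → Q` (abc-iut-L5-t2's `CosetCat.push`) and a continuous surjection `π : G_{ℚ_p} ↠ Q` (`CosetCat.pull`), the last
  arrow being the base functor of `D₀`, `CosetCat.toConnected ⋙ QuasiTemperoid.galoisPadicFields` (definitionally
  abc-iut-L1-t4 gen 3's `PadicFrd.baseZero p` of `PadicFrobenioidCZeroGalois.lean`);
  every value is a finite extension of `ℚ_p` with THE `p`-adic valuation (`relBase_isPadicLocal`); and the §2 form
  `PadicFrd.relBaseGal p Π° φ` for an open homomorphism `φ : Π → G_{ℚ_p}` itself ("`G_{ℚ_p} ⥲ Q`", Def. 2.2 p. 17: no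
  pull-back), `= P.ι ⋙ CosetCat.push φ _ ⋙ CosetCat.toConnected _ ⋙ galoisPadicFields p` at `P := CosetCat.admitsHomTo Π°`
  (`relBaseGal_eq`, the spelling of abc-iut-w5-d229's general domination-closed `P`), with `Datum.zeroRelGal`;
* "satisfies the hypotheses of Theorem 1.2 (i)": `D` connected, totally epimorphic, of FSM(FF)-type
  (`RelCosetCat.isConnected` etc., restated here as `relCosetCat_hypotheses`);
* `PadicFrd.Datum.zeroRel` — the `p`-adic Frobenioid datum `(Φ₀|_D, B₀|_D)` of Example 1.1 (ii) over `D` with `Φ = Φ₀|_D`,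
  ALL inputs discharged; and, for EVERY `d : PadicFrd.Datum (RelCosetCat Π°) p` ("the p-adic Frobenioids of Example 1.1
  (ii)" over `D`), the premise-free Theorem 1.2 chain of abc-iut-L1-d8/d10: `Φ`, `B` monoids on `D`
  (`Datum.rel_isMonoidData`), `C → F_Φ` a Frobenioid (`Datum.rel_isFrobenioid`), of standard type
  (`Datum.rel_isOfStandardType`), of model type (`Datum.rel_isOfModelType`), and Theorem 1.2 (iv) with its slimness
  premise DISCHARGED for `Π` slim profinite (`Datum.rel_isSlim_of_isSlimGroup`, via `RelCosetCat.isSlim_of_isSlim` and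
  abc-iut-L1-t4's `isSlim_cosetCat_of_isSlimGroup`).
That these small-model composites ARE print's functor: abc-iut-L1-t4's `RelCosetCat.galoisBaseFunctorIso`
(`RelCosetCategoriesGaloisBase.lean`: `toRelConnected ⋙ QuasiTemperoid.galoisBaseFunctor F Π Π° Q φ π ≅ (incl ⋙ push φ ⋙
pull π) ⋙ toConnected`, from `CosetCat.pushBridgeIso` / `pullBridgeIso`), whiskered with `galoisPadicFields p`, identifies
`relBase` with `toRelConnected ⋙ galoisBaseFunctor ℚ_[p] … ⋙ galoisPadicFields p` (all re-associations are definitional).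
Nothing of [FrdI]/[FrdII] is re-typed; no statement is strengthened; nothing here bears on [IUTchIII].
-/

namespace Literature.AlgebraicGeometry.Frobenioids

namespace PadicFrd

open CategoryTheory Literature.AnabelianGeometry.SemiGraphs

variable (p : ℕ) [Fact p.Prime]
variable {P : Type} [Group P] [TopologicalSpace P] (P₀ : OpenSubgroup P)
  {Q : Type} [Group Q] [TopologicalSpace Q]
  (φ : P →* Q) (hφ : QuasiTemperoid.IsOpenHom φ)
  (π : QuasiTemperoid.GalFbar ℚ_[p] →* Q) (hc : Continuous π) (hs : Function.Surjective π)

/-! ### The base functor `D = 𝓑^temp(Π, Π°)⁰ → D₀ → (p-adic local fields)` on the small models -/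

/-- **Example 1.3 (iii), the functor `D := 𝓑^temp(Π, Π°)⁰ → D₀ = 𝓑^temp(G_{ℚ_p})⁰` followed by `D₀ → (p-adic fields)`**, on
the small models: inclusion into `CosetCat Π`, push-forward `φ_*` along the open homomorphism `φ : Π → Q` ("`E ↦ E/Ker(φ)`",
abc-iut-L5-t2's `CosetCat.push`), pull-back `π^*` along the quotient `π : G_{ℚ_p} ↠ Q` (`CosetCat.pull`), then the base
functor of `D₀` (`CosetCat.toConnected ⋙ QuasiTemperoid.galoisPadicFields`, fixed fields with their `p`-adic valuations).
[cite: MochizukiFrdII2008, Ex 1.3 (iii) pp.11-12] -/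
noncomputable def relBase : RelCosetCat P₀ ⥤ PadicFld.{0} p :=
  RelCosetCat.incl P₀ ⋙ CosetCat.push φ hφ.isOpenMap ⋙ CosetCat.pull π hc hs ⋙
    (CosetCat.toConnected (QuasiTemperoid.isTempered_galFbar ℚ_[p]) ⋙ QuasiTemperoid.galoisPadicFields p)

/-- **The §2 form** ("`G_{ℚ_p} ⥲ Q` an isomorphism", FrdII Def. 2.2 setting p. 17): for an open homomorphism
`φ : Π → G_{ℚ_p}` itself, `D = 𝓑^temp(Π, Π°)⁰ → D₀ → (p-adic fields)` is inclusion, push-forward `φ_*`, then the base functor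
of `D₀` — no pull-back. This is the spelling `P.ι ⋙ CosetCat.push φ _ ⋙ CosetCat.toConnected _ ⋙ galoisPadicFields p` at
`P := CosetCat.admitsHomTo Π°` (abc-iut-w5-d229's general domination-closed `P`). [cite: MochizukiFrdII2008, Def 2.2 p.17] -/
noncomputable def relBaseGal (φ₀ : P →* QuasiTemperoid.GalFbar ℚ_[p]) (hφ₀ : QuasiTemperoid.IsOpenHom φ₀) :
    RelCosetCat P₀ ⥤ PadicFld.{0} p :=
  RelCosetCat.incl P₀ ⋙ CosetCat.push φ₀ hφ₀.isOpenMap ⋙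
    (CosetCat.toConnected (QuasiTemperoid.isTempered_galFbar ℚ_[p]) ⋙ QuasiTemperoid.galoisPadicFields p)

/-- `relBaseGal` unfolded to the composite over abc-iut-w4-d018's `galoisPadicFields`. [cite: MochizukiFrdII2008, Def 2.2 p.17] -/
theorem relBaseGal_eq (φ₀ : P →* QuasiTemperoid.GalFbar ℚ_[p]) (hφ₀ : QuasiTemperoid.IsOpenHom φ₀) :
    relBaseGal p P₀ φ₀ hφ₀ = (CosetCat.admitsHomTo P₀).ι ⋙ CosetCat.push φ₀ hφ₀.isOpenMap ⋙
      CosetCat.toConnected (QuasiTemperoid.isTempered_galFbar ℚ_[p]) ⋙ QuasiTemperoid.galoisPadicFields p :=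
  rfl

/-- Every value of `relBaseGal` is a finite extension of `ℚ_p` with THE `p`-adic valuation.
[cite: MochizukiFrdII2008, Def 2.2 p.17] -/
theorem relBaseGal_isPadicLocal (φ₀ : P →* QuasiTemperoid.GalFbar ℚ_[p]) (hφ₀ : QuasiTemperoid.IsOpenHom φ₀)
    (A : RelCosetCat P₀) : ((relBaseGal p P₀ φ₀ hφ₀).obj A).IsPadicLocal :=
  QuasiTemperoid.isPadicLocal_galoisPadicFields p _

/-- **Example 1.1 (ii) over the §2 base**: the datum `(Φ₀|_D, B₀|_D)` of `C₀|_D` for `D = 𝓑^temp(Π, Π°)⁰ → D₀` along an open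
homomorphism `φ : Π → G_{ℚ_p}` (all inputs discharged). [cite: MochizukiFrdII2008, Def 2.2 p.17] -/
noncomputable def Datum.zeroRelGal (φ₀ : P →* QuasiTemperoid.GalFbar ℚ_[p]) (hφ₀ : QuasiTemperoid.IsOpenHom φ₀) :
    Datum (RelCosetCat P₀) p :=
  Datum.zero (relBaseGal p P₀ φ₀ hφ₀) (relBaseGal_isPadicLocal p P₀ φ₀ hφ₀) (RelCosetCat.isConnected P₀)
    (RelCosetCat.isTotallyEpimorphic P₀) fun A => (relBaseGal_isPadicLocal p P₀ φ₀ hφ₀ A).isMonoprime_ordInt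

/-- Every value of the base functor is a finite extension of `ℚ_p` with THE `p`-adic valuation ("[cf. Example 1.1, (ii)]":
the standing hypothesis `IsPadicLocal` of the tree's `PadicFrd.Datum`). [cite: MochizukiFrdII2008, Ex 1.3 (iii) pp.11-12] -/
theorem relBase_isPadicLocal (A : RelCosetCat P₀) : ((relBase p P₀ φ hφ π hc hs).obj A).IsPadicLocal :=
  QuasiTemperoid.isPadicLocal_galoisPadicFields p _

/-- For every object `A` of `D`, `ord(O_K^⊳)` of the field `K` under `A` is monoprime (the input `hmono` of `Datum.zero`).
[cite: MochizukiFrdII2008, Ex 1.1 (i) p.7] -/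
theorem relBase_isMonoprime_ordInt (A : RelCosetCat P₀) :
    IsMonoprime (OrdInt ((relBase p P₀ φ hφ π hc hs).obj A).K) := by
  obtain ⟨inst, hfin, hcomp⟩ := (relBase_isPadicLocal p P₀ φ hφ π hc hs A).exists_finite
  letI := inst
  haveI := hfin
  exact IsMonoprime.ofZ (PadicFld.isZMonoprime_ordInt _ hcomp)

/-- **"which satisfies the hypotheses of Theorem 1.2, (i)"** (FrdII p. 12) for the small model `D = RelCosetCat Π°`: `D` is
connected, totally epimorphic, and of FSM-type, hence of FSMFF-type (abc-iut-L1-t4's `RelCosetCategories.lean`).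
[cite: MochizukiFrdII2008, Ex 1.3 (iii) pp.11-12] -/
theorem relCosetCat_hypotheses [IsTopologicalGroup P] :
    IsConnected (RelCosetCat P₀) ∧ IsTotallyEpimorphic (RelCosetCat P₀) ∧ IsOfFSMType (RelCosetCat P₀) ∧
      IsOfFSMFFType (RelCosetCat P₀) :=
  ⟨RelCosetCat.isConnected P₀, RelCosetCat.isTotallyEpimorphic P₀, RelCosetCat.isOfFSMType P₀,
    RelCosetCat.isOfFSMFFType P₀⟩

/-! ### The `p`-adic Frobenioids of Example 1.1 (ii) over `D`, and Theorem 1.2 for them -/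

/-- **Example 1.1 (ii) over `D = 𝓑^temp(Π, Π°)⁰`, the datum `(Φ₀|_D, B₀|_D, B₀|_D → Φ₀^gp|_D)`** (the `p`-adic Frobenioid
`C₀|_D`, i.e. `Φ = Φ₀|_D` — abc-iut-L1-t4's `Datum.zero` at the base `relBase`), all inputs discharged.
[cite: MochizukiFrdII2008, Ex 1.1 (ii) p.8] -/
noncomputable def Datum.zeroRel : Datum (RelCosetCat P₀) p :=
  Datum.zero (relBase p P₀ φ hφ π hc hs) (relBase_isPadicLocal p P₀ φ hφ π hc hs) (RelCosetCat.isConnected P₀)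
    (RelCosetCat.isTotallyEpimorphic P₀) (relBase_isMonoprime_ordInt p P₀ φ hφ π hc hs)

/-- The base functor of `Datum.zeroRel` is `relBase`. [cite: MochizukiFrdII2008, Ex 1.3 (iii) pp.11-12] -/
theorem zeroRel_base : (Datum.zeroRel p P₀ φ hφ π hc hs).base = relBase p P₀ φ hφ π hc hs := rfl

include hφ hc hs in
/-- In particular the type of `p`-adic Frobenioid data over `D = 𝓑^temp(Π, Π°)⁰` is inhabited.
[cite: MochizukiFrdII2008, Ex 1.3 (iii) pp.11-12] -/
theorem nonempty_datum_relCosetCat : Nonempty (Datum (RelCosetCat P₀) p) := ⟨Datum.zeroRel p P₀ φ hφ π hc hs⟩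

/-- "`Φ₀^Λ|_D` … is isomorphic to the constant monoid `ℝ_{≥0}`" over `D` (FrdII Ex. 1.1 (i)/(ii) p. 8; abc-iut-L1-t4's
`phiZeroIsoConst` at the base `relBase`). [cite: MochizukiFrdII2008, Ex 1.1 (ii) p.8] -/
noncomputable def phiZeroRelIsoConst : (Datum.zeroRel p P₀ φ hφ π hc hs).Φ ≅ constNNReal (RelCosetCat P₀) :=
  phiZeroIsoConst (relBase p P₀ φ hφ π hc hs) (relBase_isPadicLocal p P₀ φ hφ π hc hs)

variable {p P₀}
variable [IsTopologicalGroup P]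

/-- **"the main results of the theory of [Mzk5] may be applied to the `p`-adic Frobenioids of Example 1.1, (ii)"** over
`D = 𝓑^temp(Π, Π°)⁰` (FrdII p. 12): for EVERY such datum, `Φ` and `B` are monoids on `D` (the standing requirement of
[FrdI] Thm. 5.2; abc-iut-L1-d10's `isMonoidData_of_isOfFSMType` at the FSM-type base `RelCosetCat Π°`).
[cite: MochizukiFrdII2008, Ex 1.3 (iii) pp.11-12] -/
theorem Datum.rel_isMonoidData (d : Datum (RelCosetCat P₀) p) : d.IsMonoidData :=
  d.isMonoidData_of_isOfFSMType (RelCosetCat.isOfFSMType P₀)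

/-- … the `p`-adic Frobenioid `C → F_Φ` over `D` IS a Frobenioid ([FrdI] Thm. 5.2 (ii); abc-iut-L1-d8/d10's
`isFrobenioid_of_isOfFSMType`). [cite: MochizukiFrdII2008, Ex 1.3 (iii) pp.11-12] -/
theorem Datum.rel_isFrobenioid (d : Datum (RelCosetCat P₀) p) : PreFrobenioid.IsFrobenioid d.structureFunctor :=
  d.isFrobenioid_of_isOfFSMType (RelCosetCat.isOfFSMType P₀)

/-- … of standard type (Thm. 1.2 (i), third sentence, standard half; abc-iut-L1-d10's
`thm12_isOfStandardType_of_isOfFSMType`). [cite: MochizukiFrdII2008, Thm 1.2 (i) p.9] -/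
theorem Datum.rel_isOfStandardType (d : Datum (RelCosetCat P₀) p) :
    (ModelFrobenioid.data d.Φ d.B d.divB).IsOfStandardType :=
  d.thm12_isOfStandardType_of_isOfFSMType (RelCosetCat.isOfFSMType P₀)

/-- … of model type (Thm. 1.2 (i); [FrdI] Def. 4.5 (i) at THE birationalization; abc-iut-w4-d108 / abc-iut-L1-d10's
`thm12_isOfModelType_of_isOfFSMType'`). [cite: MochizukiFrdII2008, Thm 1.2 (i) p.9] -/
theorem Datum.rel_isOfModelType (d : Datum (RelCosetCat P₀) p) :
    PreFrobenioid.IsOfModelType d.structureFunctor (d.isFrobenioid_of_isOfFSMType (RelCosetCat.isOfFSMType P₀))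
      (d.hasBiratSquares (d.isFrobenioid_of_isOfFSMType (RelCosetCat.isOfFSMType P₀))) :=
  d.thm12_isOfModelType_of_isOfFSMType' (RelCosetCat.isOfFSMType P₀)

omit [IsTopologicalGroup P] in
/-- … of isotropic type (Thm. 1.2 (i); abc-iut-L1-d10's `thm12_isOfIsotropicType`). [cite: MochizukiFrdII2008, Thm 1.2 (i) p.9] -/
theorem Datum.rel_isOfIsotropicType (d : Datum (RelCosetCat P₀) p) :
    PreFrobenioid.IsOfIsotropicType d.structureFunctor :=
  d.thm12_isOfIsotropicType

/-- **Theorem 1.2 (iv) over `D = 𝓑^temp(Π, Π°)⁰` with its premise DISCHARGED**: for `Π` a slim PROFINITE group, every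
`p`-adic Frobenioid over `D` is a slim category — "`D` slim" because `𝓑^temp(Π)⁰ = CosetCat Π` is slim (abc-iut-L1-t4's
`isSlim_cosetCat_of_isSlimGroup` over gen 3's `CosetCat.isSlim_of_isSlimGroup`) and `𝓑^temp(Π, Π°)⁰` inherits it
(`RelCosetCat.isSlim_of_isSlim`); then abc-iut-L1-d8's `thm12_iv_of_isMonoidData`. [cite: MochizukiFrdII2008, Thm 1.2 (iv) p.9] -/
theorem Datum.rel_isSlim_of_isSlimGroup [CompactSpace P] [TotallyDisconnectedSpace P] (hZ : IsSlimGroup P)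
    (d : Datum (RelCosetCat P₀) p) : IsSlim d.frobenioid :=
  d.thm12_iv_of_isMonoidData d.rel_isMonoidData
    (RelCosetCat.isSlim_of_isSlim P₀ (isSlim_cosetCat_of_isSlimGroup hZ))

end PadicFrd

end Literature.AlgebraicGeometry.Frobenioids
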